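import Summits.QuantumFields.YangMills.Theorems.BalabanUVNodesN15BackgroundByPartsNode
import Summits.QuantumFields.YangMills.Theorems.BalabanUVNodesN15TwoGridEntry3Full
import Summits.QuantumFields.YangMills.Theorems.BalabanUVNodesN15TwoGridReadoutFull
import HarnessLib

/-!
# Route «BalabanUVNodes» (K4 «SpineRates»), node N15 = NE2 — ★★★ `T4EtaRate.NE2PlusOperator` BY NAME FOR BAŁABAN's FULL `U ≡ 1` LANDAU-GAUGE PROPAGATOR `G = Δ_b⁻¹` DRESSED BY A
# LIVE FIRST-ORDER SCALAR BACKGROUND, ALL FOUR (3.42) ENTRIES CONSTRUCTED, ENTRY 2 BY PARTS — §3 modulo the `U ≡ 1` entry-2 η-defect, §4 HYPOTHESIS-FREE with dag-n15-a's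
# part 71 `hasMaj_twoGridDefect_div` (exponent `1∕(8(d+1))`)

Cell `pub-ymgap`, seat `pub-ymgap-dag-n15-c` (generation g8; R134 ACCELERATION SEAT, strategy s1; HUMAN RULING D-0062; chair R424 venue; `bears_on: R4∕N15`).  Filed
`--kind proof --supports stmt-QuantumFields-20544 --as helper` (K3⁷ `SpineGivenEndpointR13SepCoPH`, dag-lead WORDS-143; count-neutral).  Imports BY NAME this seat's `…N15BackgroundByPartsNode` (FILE 7b: `ne2PlusOperator_byParts`,
`coeffBgBP`, `bgInstanceBP`, `bgFamilyBP`; through it FILES 1–7a and FILE 4's torus letters `hasMaj_fshift`, `hasMaj_shiftDefect_fullG`, `symbOp_sD_eq`, `symbOp_sTinv_sub_one_eq`),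
dag-n15-a's `…TwoGridEntry3Full` (`hasMaj_twoGridDefect_lap`, entry 3 hypothesis-free) and `…TwoGridReadoutFull` (`TGIndex`, `TGIndex.Mn`, part 71 `hasMaj_twoGridDefect_div` = ENTRY 2 hypothesis-free; through it parts 42∕59 `ineq110_114_pair`,
`hasMaj_gOp_of_ineq`, `hasMaj_grad_of_ineq`, `hasMaj_gDivAdj_of_ineq`, `hasMaj_lap_of_ineq`, `hasMaj_twoGridDefect`, `hasMaj_twoGridDefect_grad`); nothing in the tree is modified.

WHY ∕ WHAT.  HANDOFF §g7 located (G5) «the background-live OPERATOR layer on Bałaban's full `U ≡ 1` propagator»; this generation found it OBSTRUCTED in the lineage's sup currency (the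
mixed letter `∇G∇*` is log-divergent) and REPAIRED it by the right Neumann form (3.64)–(3.65) + lattice integration by parts (FILES 1–7).  THIS FILE is the knit: §1 the realised
family `fgInstance d hL γ i` ∕ `fgFamily d hL b γ i` over the torus family of record (index `i = ((m_T, k ≥ 1, m), ν)`; `G = gOp`, `D_μ = ∇_μG = fgrad (L^k) (bshiftEquiv μ) ∘ G` (`fgD`),
`D₃ = ΔG`, coefficient carrier `coeffBgBP` with rate number `(L^k)^{−γ}`); §2 ★★ `uniform_layer_fullG` — the thirteen UNIFORM `U ≡ 1` letters, EVERY ONE A TREE THEOREM ((1.110) majorants of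
`G, ∇G, ΔG, G∇*` at both spacings; the η-defects of `G` (p519229), `∇G` (part 59), `ΔG` (entry 3); the shift costs and the shift-defect row letter for every regular coefficient family
(FILE 4 ★★)); §3 ★★★ **`ne2PlusOperator_fullG_byParts_of_entry2`**: for odd `L ≥ 3`, `b > 0`, `c₃₅ > 0`, `0 < γ ≤ 1∕16`, IF `𝔇(G′∇′_ν*, G∇_ν*) ≤ B₂(L^k)^{−γ}e^{−δ₂d}` uniformly (dag-n15-a's
entry 2 — the ONLY displayed input) THEN `NE2PlusOperator c₃₅ (fgInstance d hL γ) (fgFamily d hL b γ)`; §4 ★★★ **`ne2PlusOperator_fullG_byParts`** (`d ≥ 1`, `γ = 1∕(8(d+1))`): the same with NO displayed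
binder — dag-n15-a's part 71 `hasMaj_twoGridDefect_div` (landed 15:52Z, p544964) IS that input (bridged by FILE 4 `symbOp_sTinv_sub_one_eq`); `_dim4` (`γ = 1∕32`).

HONEST FRAMING ∕ LIMITS.  `U ≡ 1` torus family at fixed coupling `b`; the background is the lineage's first-order SCALAR species (abelianised coefficients `c′, a′_μ` with the
(3.35)–(3.36)-type letters of `coeffBgBP` as hypothesis shapes, coarse partner = block averages), not Bałaban's full non-abelian `V′(A)` of (3.52)∕(3.60); constants crude and ours; MODEL-LEVEL in the background species, GENUINE in the propagator.  NE2⁺ NOT PRINTED, NOT proved as printed, not claimed;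
count-neutral (typed 28∕28 · discharged 5∕27 of record unchanged); N15 NOT discharged; one finite T⁴ at fixed ε — NOT ℝ⁴, NOT infinite volume, NOT OS, NOT a mass gap, NOT Clay.
-/

noncomputable section

open scoped BigOperators
open Finset

namespace Summit.QuantumFields.YangMills.BalabanUVNodes.N15.BackgroundLayer

open Literature.MathematicalPhysics.QuantumFieldTheory.Balaban1983to89
open Literature.MathematicalPhysics.QuantumFieldTheory.Balaban1983to89.B11SectG (BlockNorm HasMaj RowSum)
open Literature.MathematicalPhysics.QuantumFieldTheory.Balaban1983to89.T4EtaRate (PairedInstance NE2PlusOperator rateFactor)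
open Literature.MathematicalPhysics.QuantumFieldTheory.Balaban1983to89.T4EtaRateDefect (idef idef_apply rateWeight)
open Literature.MathematicalPhysics.QuantumFieldTheory.Balaban1983to89.T4EtaRateCoeffDefect (pull pull_apply diagK diagK_nonneg FibreOsc blockAvg fit_blockAvg)
open Literature.MathematicalPhysics.QuantumFieldTheory.Balaban1983to89.B6Prop26Gluing (mulOp mulOp_apply)
open Literature.MathematicalPhysics.QuantumFieldTheory.Balaban1983to89.B5Prop11Plancherel (Tor fine unitVec)
open Literature.MathematicalPhysics.QuantumFieldTheory.Balaban1983to89.B5SiteBridgeP12 (MP)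
open Literature.MathematicalPhysics.QuantumFieldTheory.Balaban1983to89.B6UnitTorusCarrier (unitTorusGeo triangle254_unitTorusGeo rowSum_unitTorusGeo unitTorusGeo_dist_nonneg
  unitTorusGeo_len)
open Literature.MathematicalPhysics.QuantumFieldTheory.King1986.Torus (blockOf tdistT tdistT_nonneg tdistT_self)
open Summit.QuantumFields.YangMills.BalabanUVNodes.N15.MatrixSpecies (liftMap liftBlk)
open Summit.QuantumFields.YangMills.BalabanUVNodes.N15.TwoGrid (gOp symbOp sT sTinv sD sLap ineq110_114_pair hasMaj_gOp_of_ineq hasMaj_grad_of_ineq hasMaj_gDivAdj_of_ineq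
  hasMaj_lap_of_ineq paramsOf hasMaj_rate_mono hasMaj_twoGridDefect hasMaj_twoGridDefect_grad hasMaj_twoGridDefect_lap hasMaj_twoGridDefect_div hasMaj_rescale TGIndex
  TGIndex.Mn)
open Summit.QuantumFields.YangMills.BalabanUVNodes.N15.VectorPiece (blkFine kingPrV blkFine_comp_kingPrV bshiftEquiv bshiftEquiv_apply bshiftEquiv_symm_apply)

variable {d : ℕ} {L : ℕ} [NeZero L]

/-! ## §1 The realised by-parts family at Bałaban's full `U ≡ 1` propagator on the torus family of record -/

section Family

variable (d)

/-- the forward-derivative pieces `∇_μG = fgrad n (bshiftEquiv μ) ∘ G` of the full propagator at fineness `n` (= dag-n15-a's `ρ(sD_μ n)∘gOp`, FILE 4 `symbOp_sD_eq`).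
[cite: Balaban1984PropagatorsI, Prop. 1.2 (1.110) p.35 (the entry «∇GJ»: shape)] -/
def fgD (M : Fin (d + 1) → ℕ) [∀ μ, NeZero (M μ)] (n : ℕ) [NeZero n] (b : ℝ) (μ : Fin (d + 1)) :
    (Tor (fine n M) × Fin (d + 1) → ℝ) →ₗ[ℝ] (Tor (fine n M) × Fin (d + 1) → ℝ) :=
  fgrad (n : ℝ) (bshiftEquiv M n μ) ∘ₗ gOp M n b

/-- THE REALISED PAIRED INSTANCE at an index `(i, ν)` of the torus family of record and a rate exponent `γ`: FILE 7a's `bgInstanceBP` over the unit-torus carrier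
(`M_μ = 2L^{m_T}`, spacings `L^{−k}` ∕ `L^{−m−k}`, King's pairing, translations `bshiftEquiv`, rate number `θ = (L^k)^{−γ}`). [cite: Balaban1985BackgroundPropagators, Thm 3.14 pp.426–427 (typing template)] -/
def fgInstance (hL : Odd L ∧ 1 < L) (γ : ℝ) (i : TGIndex × Fin (d + 1)) : PairedInstance :=
  bgInstanceBP (Fin (d + 1)) (g := unitTorusGeo L i.1.k (TGIndex.Mn d hL i.1)) (blkFine L i.1.k (TGIndex.Mn d hL i.1)) (kingPrV L i.1.k i.1.m (TGIndex.Mn d hL i.1))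
    (fun μ => bshiftEquiv (TGIndex.Mn d hL i.1) (L ^ i.1.k) μ) (fun μ => bshiftEquiv (TGIndex.Mn d hL i.1) (L ^ i.1.m * L ^ i.1.k) μ) ((L ^ i.1.k : ℕ) : ℝ)
    ((L ^ i.1.m * L ^ i.1.k : ℕ) : ℝ) i.1.m (Nat.cast_ne_zero.mpr (NeZero.ne L)) (((L : ℝ) ^ i.1.k) ^ (-γ)) (((L : ℝ) ^ i.1.k) ^ (-γ))

/-- THE REALISED BY-PARTS KERNEL FAMILY at `(i, ν)`: FILE 7a's `bgFamilyBP` with `G = gOp` (Bałaban's full Landau-gauge `U ≡ 1` propagator), `D_μ = ∇_μG`, `D₃ = ΔG`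
(`ρ(sLap)∘gOp`) at both spacings — all four (3.42) entries CONSTRUCTED, entry 2 BY PARTS. [cite: Balaban1985BackgroundPropagators, (3.42) p.397 (shape)] -/
def fgFamily (hL : Odd L ∧ 1 < L) (b γ : ℝ) (i : TGIndex × Fin (d + 1)) : B9.KernelFamily (fgInstance d hL γ i).gc (fgInstance d hL γ i).Bf :=
  bgFamilyBP (J := Fin (d + 1)) (g := unitTorusGeo L i.1.k (TGIndex.Mn d hL i.1)) (blkFine L i.1.k (TGIndex.Mn d hL i.1)) (kingPrV L i.1.k i.1.m (TGIndex.Mn d hL i.1))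
    (fun μ => bshiftEquiv (TGIndex.Mn d hL i.1) (L ^ i.1.k) μ) (fun μ => bshiftEquiv (TGIndex.Mn d hL i.1) (L ^ i.1.m * L ^ i.1.k) μ) ((L ^ i.1.k : ℕ) : ℝ)
    ((L ^ i.1.m * L ^ i.1.k : ℕ) : ℝ) i.1.m (Nat.cast_ne_zero.mpr (NeZero.ne L)) (((L : ℝ) ^ i.1.k) ^ (-γ)) (((L : ℝ) ^ i.1.k) ^ (-γ)) i.2
    (gOp (TGIndex.Mn d hL i.1) (L ^ i.1.k) b)
    (symbOp (TGIndex.Mn d hL i.1) (L ^ i.1.k) (sLap (TGIndex.Mn d hL i.1) (L ^ i.1.k) ((L ^ i.1.k : ℕ) : ℝ)) ∘ₗ gOp (TGIndex.Mn d hL i.1) (L ^ i.1.k) b)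
    (fgD d (TGIndex.Mn d hL i.1) (L ^ i.1.k) b)
    (gOp (TGIndex.Mn d hL i.1) (L ^ i.1.m * L ^ i.1.k) b)
    (symbOp (TGIndex.Mn d hL i.1) (L ^ i.1.m * L ^ i.1.k) (sLap (TGIndex.Mn d hL i.1) (L ^ i.1.m * L ^ i.1.k) ((L ^ i.1.m * L ^ i.1.k : ℕ) : ℝ)) ∘ₗ
      gOp (TGIndex.Mn d hL i.1) (L ^ i.1.m * L ^ i.1.k) b)
    (fgD d (TGIndex.Mn d hL i.1) (L ^ i.1.m * L ^ i.1.k) b)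

end Family

/-! ## §2 The UNIFORM `U ≡ 1` letters of the by-parts family at `gOp` — every one a tree theorem (dag-n15-a parts 42∕54∕59∕66, p519229, FILE 4) -/

section Letters

/-- domination of a rate letter into weaker uniform constants: `C·x^{−a}·e^{−δ′t} ≤ m·x^{−b}·e^{−δt}` for `0 ≤ C ≤ m`, `x ≥ 1`, `b ≤ a`, `δ ≤ δ′`, `t ≥ 0`. [folklore] -/
theorem le_rate {C m x a b δ δ' t : ℝ} (hC0 : 0 ≤ C) (hCm : C ≤ m) (hx : 1 ≤ x) (hab : b ≤ a) (hδ : δ ≤ δ') (ht : 0 ≤ t) :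
    C * x ^ (-a) * Real.exp (-(δ' * t)) ≤ m * x ^ (-b) * Real.exp (-(δ * t)) := by
  have h1 : x ^ (-a) ≤ x ^ (-b) := Real.rpow_le_rpow_of_exponent_le hx (neg_le_neg hab)
  have h2 : Real.exp (-(δ' * t)) ≤ Real.exp (-(δ * t)) := Real.exp_le_exp.mpr (by nlinarith)
  have hxb : 0 ≤ x ^ (-b) := Real.rpow_nonneg (by linarith) _
  exact mul_le_mul (mul_le_mul hCm h1 (Real.rpow_nonneg (by linarith) _) (hC0.trans hCm)) h2 (Real.exp_nonneg _) (mul_nonneg (hC0.trans hCm) hxb)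

variable (d)

/-- ★★ **THE UNIFORM `U ≡ 1` LETTERS OF THE BY-PARTS FAMILY AT BAŁABAN's FULL PROPAGATOR**, all tree theorems: for odd `L ≥ 3`, `b > 0`, `0 < γ ≤ 1∕16`, `c₃₅ > 0` and any target rate
`δ₂ > 0` and constant `B₂ ≥ 0`, there are `δ ∈ (0, δ₂]`, `β, m₀ ≥ B₂, c_T, m_T > 0` such that at every index `(m_T, k ≥ 1, m, ν)`: the (1.110) majorants of `G, ∇_μG, ΔG, G∇_ν*` at both
spacings (part 42), the η-defects of `G` (p519229, exponent `2γ`), `∇_μG` (part 59, exponent `1∕16 ≥ γ`), `ΔG` (entry 3, exponent `2γ`) as `m₀·(L^k)^{−γ}·e^{−δd}`, the shift costs `e^{δ}`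
(FILE 4 §2) and the SHIFT-DEFECT ROW LETTER for every `Reg335`-regular coefficient family of `coeffBgBP` (FILE 4 ★★ at `α = γ` with the carrier's sup and coarse-oscillation letters:
`≤ m_T·(c₃₅Mα₀)·(L^k)^{−γ}·e^{−δd}`). [cite: Balaban1984PropagatorsI, Prop. 1.2 (1.110)–(1.111) p.35; King1986, p.664 (pairing)] -/
theorem uniform_layer_fullG (hLodd : Odd L) (hL2 : 2 ≤ L) (hL : Odd L ∧ 1 < L) {b : ℝ} (hb : 0 < b) {γ : ℝ} (hγ0 : 0 < γ) (hγ1 : γ ≤ 1 / 16) (c35 : ℝ)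
    {δ₂ B₂ : ℝ} (hδ₂ : 0 < δ₂) (hB₂ : 0 ≤ B₂) :
    ∃ δ β m₀ cT mT : ℝ, 0 < δ ∧ δ ≤ δ₂ ∧ 0 < β ∧ 0 < m₀ ∧ B₂ ≤ m₀ ∧ 0 < cT ∧ 0 < mT ∧ ∀ i : TGIndex × Fin (d + 1),
      HasMaj (BlockNorm.ofBlocks (unitTorusGeo L i.1.k (TGIndex.Mn d hL i.1)) (blkFine L i.1.k (TGIndex.Mn d hL i.1)))
          (BlockNorm.ofBlocks (unitTorusGeo L i.1.k (TGIndex.Mn d hL i.1)) (blkFine L i.1.k (TGIndex.Mn d hL i.1))) (gOp (TGIndex.Mn d hL i.1) (L ^ i.1.k) b)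
          (fun y y' => β * Real.exp (-(δ * (unitTorusGeo L i.1.k (TGIndex.Mn d hL i.1)).dist y y'))) ∧
      (∀ μ, HasMaj (BlockNorm.ofBlocks (unitTorusGeo L i.1.k (TGIndex.Mn d hL i.1)) (blkFine L i.1.k (TGIndex.Mn d hL i.1)))
          (BlockNorm.ofBlocks (unitTorusGeo L i.1.k (TGIndex.Mn d hL i.1)) (blkFine L i.1.k (TGIndex.Mn d hL i.1))) (fgD d (TGIndex.Mn d hL i.1) (L ^ i.1.k) b μ)
          (fun y y' => β * Real.exp (-(δ * (unitTorusGeo L i.1.k (TGIndex.Mn d hL i.1)).dist y y')))) ∧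
      HasMaj (BlockNorm.ofBlocks (unitTorusGeo L i.1.k (TGIndex.Mn d hL i.1)) (blkFine L i.1.k (TGIndex.Mn d hL i.1) ∘ kingPrV L i.1.k i.1.m (TGIndex.Mn d hL i.1)))
          (BlockNorm.ofBlocks (unitTorusGeo L i.1.k (TGIndex.Mn d hL i.1)) (blkFine L i.1.k (TGIndex.Mn d hL i.1) ∘ kingPrV L i.1.k i.1.m (TGIndex.Mn d hL i.1)))
          (gOp (TGIndex.Mn d hL i.1) (L ^ i.1.m * L ^ i.1.k) b) (fun y y' => β * Real.exp (-(δ * (unitTorusGeo L i.1.k (TGIndex.Mn d hL i.1)).dist y y'))) ∧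
      (∀ μ, HasMaj (BlockNorm.ofBlocks (unitTorusGeo L i.1.k (TGIndex.Mn d hL i.1)) (blkFine L i.1.k (TGIndex.Mn d hL i.1) ∘ kingPrV L i.1.k i.1.m (TGIndex.Mn d hL i.1)))
          (BlockNorm.ofBlocks (unitTorusGeo L i.1.k (TGIndex.Mn d hL i.1)) (blkFine L i.1.k (TGIndex.Mn d hL i.1) ∘ kingPrV L i.1.k i.1.m (TGIndex.Mn d hL i.1)))
          (fgD d (TGIndex.Mn d hL i.1) (L ^ i.1.m * L ^ i.1.k) b μ) (fun y y' => β * Real.exp (-(δ * (unitTorusGeo L i.1.k (TGIndex.Mn d hL i.1)).dist y y')))) ∧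
      HasMaj (BlockNorm.ofBlocks (unitTorusGeo L i.1.k (TGIndex.Mn d hL i.1)) (blkFine L i.1.k (TGIndex.Mn d hL i.1) ∘ kingPrV L i.1.k i.1.m (TGIndex.Mn d hL i.1)))
          (BlockNorm.ofBlocks (unitTorusGeo L i.1.k (TGIndex.Mn d hL i.1)) (blkFine L i.1.k (TGIndex.Mn d hL i.1) ∘ kingPrV L i.1.k i.1.m (TGIndex.Mn d hL i.1)))
          (symbOp (TGIndex.Mn d hL i.1) (L ^ i.1.m * L ^ i.1.k) (sLap (TGIndex.Mn d hL i.1) (L ^ i.1.m * L ^ i.1.k) ((L ^ i.1.m * L ^ i.1.k : ℕ) : ℝ)) ∘ₗ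
            gOp (TGIndex.Mn d hL i.1) (L ^ i.1.m * L ^ i.1.k) b) (fun y y' => β * Real.exp (-(δ * (unitTorusGeo L i.1.k (TGIndex.Mn d hL i.1)).dist y y'))) ∧
      HasMaj (BlockNorm.ofBlocks (unitTorusGeo L i.1.k (TGIndex.Mn d hL i.1)) (blkFine L i.1.k (TGIndex.Mn d hL i.1)))
          (BlockNorm.ofBlocks (unitTorusGeo L i.1.k (TGIndex.Mn d hL i.1)) (blkFine L i.1.k (TGIndex.Mn d hL i.1) ∘ kingPrV L i.1.k i.1.m (TGIndex.Mn d hL i.1)))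
          (idef (pull (kingPrV L i.1.k i.1.m (TGIndex.Mn d hL i.1))) (pull (kingPrV L i.1.k i.1.m (TGIndex.Mn d hL i.1)))
            (gOp (TGIndex.Mn d hL i.1) (L ^ i.1.m * L ^ i.1.k) b) (gOp (TGIndex.Mn d hL i.1) (L ^ i.1.k) b))
          (fun y y' => m₀ * ((L : ℝ) ^ i.1.k) ^ (-γ) * Real.exp (-(δ * (unitTorusGeo L i.1.k (TGIndex.Mn d hL i.1)).dist y y'))) ∧
      (∀ μ, HasMaj (BlockNorm.ofBlocks (unitTorusGeo L i.1.k (TGIndex.Mn d hL i.1)) (blkFine L i.1.k (TGIndex.Mn d hL i.1)))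
          (BlockNorm.ofBlocks (unitTorusGeo L i.1.k (TGIndex.Mn d hL i.1)) (blkFine L i.1.k (TGIndex.Mn d hL i.1) ∘ kingPrV L i.1.k i.1.m (TGIndex.Mn d hL i.1)))
          (idef (pull (kingPrV L i.1.k i.1.m (TGIndex.Mn d hL i.1))) (pull (kingPrV L i.1.k i.1.m (TGIndex.Mn d hL i.1)))
            (fgD d (TGIndex.Mn d hL i.1) (L ^ i.1.m * L ^ i.1.k) b μ) (fgD d (TGIndex.Mn d hL i.1) (L ^ i.1.k) b μ))
          (fun y y' => m₀ * ((L : ℝ) ^ i.1.k) ^ (-γ) * Real.exp (-(δ * (unitTorusGeo L i.1.k (TGIndex.Mn d hL i.1)).dist y y')))) ∧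
      HasMaj (BlockNorm.ofBlocks (unitTorusGeo L i.1.k (TGIndex.Mn d hL i.1)) (blkFine L i.1.k (TGIndex.Mn d hL i.1)))
          (BlockNorm.ofBlocks (unitTorusGeo L i.1.k (TGIndex.Mn d hL i.1)) (blkFine L i.1.k (TGIndex.Mn d hL i.1) ∘ kingPrV L i.1.k i.1.m (TGIndex.Mn d hL i.1)))
          (idef (pull (kingPrV L i.1.k i.1.m (TGIndex.Mn d hL i.1))) (pull (kingPrV L i.1.k i.1.m (TGIndex.Mn d hL i.1)))
            (symbOp (TGIndex.Mn d hL i.1) (L ^ i.1.m * L ^ i.1.k) (sLap (TGIndex.Mn d hL i.1) (L ^ i.1.m * L ^ i.1.k) ((L ^ i.1.m * L ^ i.1.k : ℕ) : ℝ)) ∘ₗ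
              gOp (TGIndex.Mn d hL i.1) (L ^ i.1.m * L ^ i.1.k) b)
            (symbOp (TGIndex.Mn d hL i.1) (L ^ i.1.k) (sLap (TGIndex.Mn d hL i.1) (L ^ i.1.k) ((L ^ i.1.k : ℕ) : ℝ)) ∘ₗ gOp (TGIndex.Mn d hL i.1) (L ^ i.1.k) b))
          (fun y y' => m₀ * ((L : ℝ) ^ i.1.k) ^ (-γ) * Real.exp (-(δ * (unitTorusGeo L i.1.k (TGIndex.Mn d hL i.1)).dist y y'))) ∧
      (∀ ν, HasMaj (BlockNorm.ofBlocks (unitTorusGeo L i.1.k (TGIndex.Mn d hL i.1)) (blkFine L i.1.k (TGIndex.Mn d hL i.1)))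
          (BlockNorm.ofBlocks (unitTorusGeo L i.1.k (TGIndex.Mn d hL i.1)) (blkFine L i.1.k (TGIndex.Mn d hL i.1)))
          (gOp (TGIndex.Mn d hL i.1) (L ^ i.1.k) b ∘ₗ fgradAdj ((L ^ i.1.k : ℕ) : ℝ) (bshiftEquiv (TGIndex.Mn d hL i.1) (L ^ i.1.k) ν))
          (fun y y' => β * Real.exp (-(δ * (unitTorusGeo L i.1.k (TGIndex.Mn d hL i.1)).dist y y')))) ∧
      (∀ ν, HasMaj (BlockNorm.ofBlocks (unitTorusGeo L i.1.k (TGIndex.Mn d hL i.1)) (blkFine L i.1.k (TGIndex.Mn d hL i.1) ∘ kingPrV L i.1.k i.1.m (TGIndex.Mn d hL i.1)))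
          (BlockNorm.ofBlocks (unitTorusGeo L i.1.k (TGIndex.Mn d hL i.1)) (blkFine L i.1.k (TGIndex.Mn d hL i.1) ∘ kingPrV L i.1.k i.1.m (TGIndex.Mn d hL i.1)))
          (gOp (TGIndex.Mn d hL i.1) (L ^ i.1.m * L ^ i.1.k) b ∘ₗ fgradAdj ((L ^ i.1.m * L ^ i.1.k : ℕ) : ℝ) (bshiftEquiv (TGIndex.Mn d hL i.1) (L ^ i.1.m * L ^ i.1.k) ν))
          (fun y y' => β * Real.exp (-(δ * (unitTorusGeo L i.1.k (TGIndex.Mn d hL i.1)).dist y y')))) ∧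
      (∀ μ, HasMaj (BlockNorm.ofBlocks (unitTorusGeo L i.1.k (TGIndex.Mn d hL i.1)) (blkFine L i.1.k (TGIndex.Mn d hL i.1)))
          (BlockNorm.ofBlocks (unitTorusGeo L i.1.k (TGIndex.Mn d hL i.1)) (blkFine L i.1.k (TGIndex.Mn d hL i.1))) (pull ⇑(bshiftEquiv (TGIndex.Mn d hL i.1) (L ^ i.1.k) μ))
          (fun y y' => cT * Real.exp (-(δ * (unitTorusGeo L i.1.k (TGIndex.Mn d hL i.1)).dist y y')))) ∧
      (∀ μ, HasMaj (BlockNorm.ofBlocks (unitTorusGeo L i.1.k (TGIndex.Mn d hL i.1)) (blkFine L i.1.k (TGIndex.Mn d hL i.1) ∘ kingPrV L i.1.k i.1.m (TGIndex.Mn d hL i.1)))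
          (BlockNorm.ofBlocks (unitTorusGeo L i.1.k (TGIndex.Mn d hL i.1)) (blkFine L i.1.k (TGIndex.Mn d hL i.1) ∘ kingPrV L i.1.k i.1.m (TGIndex.Mn d hL i.1)))
          (pull ⇑(bshiftEquiv (TGIndex.Mn d hL i.1) (L ^ i.1.m * L ^ i.1.k) μ)) (fun y y' => cT * Real.exp (-(δ * (unitTorusGeo L i.1.k (TGIndex.Mn d hL i.1)).dist y y')))) ∧
      (∀ (U : (Tor (fine (L ^ i.1.m * L ^ i.1.k) (TGIndex.Mn d hL i.1)) × Fin (d + 1) → ℝ) × (Fin (d + 1) → Tor (fine (L ^ i.1.m * L ^ i.1.k) (TGIndex.Mn d hL i.1)) × Fin (d + 1) → ℝ))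
          (α₀ : ℝ), (coeffBgBP (Fin (d + 1)) (kingPrV L i.1.k i.1.m (TGIndex.Mn d hL i.1)) (fun μ => bshiftEquiv (TGIndex.Mn d hL i.1) (L ^ i.1.k) μ)
            (fun μ => bshiftEquiv (TGIndex.Mn d hL i.1) (L ^ i.1.m * L ^ i.1.k) μ) ((L ^ i.1.k : ℕ) : ℝ) ((L ^ i.1.m * L ^ i.1.k : ℕ) : ℝ)
            (unitTorusGeo L i.1.k (TGIndex.Mn d hL i.1)).M (((L : ℝ) ^ i.1.k) ^ (-γ))).Reg335 c35 α₀ U →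
        ∀ μ, HasMaj (BlockNorm.ofBlocks (unitTorusGeo L i.1.k (TGIndex.Mn d hL i.1)) (liftBlk (blkFine L i.1.k (TGIndex.Mn d hL i.1)) (Fin (d + 1))))
          (BlockNorm.ofBlocks (unitTorusGeo L i.1.k (TGIndex.Mn d hL i.1)) (blkFine L i.1.k (TGIndex.Mn d hL i.1) ∘ kingPrV L i.1.k i.1.m (TGIndex.Mn d hL i.1)))
          (idef (pull (kingPrV L i.1.k i.1.m (TGIndex.Mn d hL i.1))) (pull (kingPrV L i.1.k i.1.m (TGIndex.Mn d hL i.1)))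
              (pull ⇑(bshiftEquiv (TGIndex.Mn d hL i.1) (L ^ i.1.m * L ^ i.1.k) μ)) (pull ⇑(bshiftEquiv (TGIndex.Mn d hL i.1) (L ^ i.1.k) μ)) ∘ₗ
            (mulOp ((avg₁ (Fin (d + 1)) (kingPrV L i.1.k i.1.m (TGIndex.Mn d hL i.1)) U).2 μ ∘ ⇑(bshiftEquiv (TGIndex.Mn d hL i.1) (L ^ i.1.k) μ).symm) ∘ₗ
              sumJ fun ν => gOp (TGIndex.Mn d hL i.1) (L ^ i.1.k) b ∘ₗ fgradAdj ((L ^ i.1.k : ℕ) : ℝ) (bshiftEquiv (TGIndex.Mn d hL i.1) (L ^ i.1.k) ν)))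
          (fun y y' => mT * (c35 * (unitTorusGeo L i.1.k (TGIndex.Mn d hL i.1)).M * α₀) * ((L : ℝ) ^ i.1.k) ^ (-γ) *
            Real.exp (-(δ * (unitTorusGeo L i.1.k (TGIndex.Mn d hL i.1)).dist y y')))) := by
  have hL0 : 0 < L := by omega
  have hLr1 : (1 : ℝ) ≤ (L : ℝ) := by exact_mod_cast (show 1 ≤ L by omega)
  have h2γ0 : 0 < 2 * γ := by linarith
  have h2γ1 : 2 * γ < 1 := by linarith
  have hγlt1 : γ < 1 := by linarith
  obtain ⟨δ₀, C₀, Cα, Cε, Cαε, hδ₀, hC₀, HP⟩ := ineq110_114_pair (d := d) hL hb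
  obtain ⟨δ₁, C₁, hδ₁, hC₁, H0⟩ := hasMaj_twoGridDefect (d := d) hLodd hL2 hb h2γ0 h2γ1
  obtain ⟨δ₅, C₅, hδ₅, hC₅, H1⟩ := hasMaj_twoGridDefect_grad (d := d) hLodd hL2 hb
  obtain ⟨δ₃, C₃, hδ₃, hC₃, H3⟩ := hasMaj_twoGridDefect_lap (d := d) hLodd hL2 hb h2γ0 h2γ1
  obtain ⟨δ₄, C₄, hδ₄, hC₄, H4⟩ := hasMaj_shiftDefect_fullG (d := d) hLodd hL2 hb hγ0.le hγlt1
  set δ : ℝ := min (min (min δ₀ δ₁) (min δ₅ δ₃)) (min δ₄ δ₂) with hδdef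
  have hδ : 0 < δ := lt_min (lt_min (lt_min hδ₀ hδ₁) (lt_min hδ₅ hδ₃)) (lt_min hδ₄ hδ₂)
  have hδ₀' : δ ≤ δ₀ := ((min_le_left _ _).trans (min_le_left _ _)).trans (min_le_left _ _)
  have hδ₁' : δ ≤ δ₁ := ((min_le_left _ _).trans (min_le_left _ _)).trans (min_le_right _ _)
  have hδ₅' : δ ≤ δ₅ := ((min_le_left _ _).trans (min_le_right _ _)).trans (min_le_left _ _)
  have hδ₃' : δ ≤ δ₃ := ((min_le_left _ _).trans (min_le_right _ _)).trans (min_le_right _ _)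
  have hδ₄' : δ ≤ δ₄ := (min_le_right _ _).trans (min_le_left _ _)
  have hδ₂' : δ ≤ δ₂ := (min_le_right _ _).trans (min_le_right _ _)
  set m₀ : ℝ := C₁ + C₅ + C₃ + B₂ with hm₀def
  have hm₀ : 0 < m₀ := by positivity
  refine ⟨δ, C₀, m₀, Real.exp δ, 2 * C₄, hδ, hδ₂', hC₀, hm₀, by rw [hm₀def]; linarith, Real.exp_pos δ, by positivity, fun i => ?_⟩
  obtain ⟨⟨mT, k, hk, m⟩, ν⟩ := i
  simp only
  have hn1 : 1 ≤ L ^ k := Nat.one_le_pow _ _ hL0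
  have hn1' : 1 ≤ L ^ m * L ^ k := Nat.one_le_iff_ne_zero.mpr (by positivity)
  have hx1 : (1 : ℝ) ≤ (L : ℝ) ^ k := one_le_pow₀ hLr1
  have hxθ : 0 ≤ ((L : ℝ) ^ k) ^ (-γ) := Real.rpow_nonneg (by positivity) _
  have hcast : ((L ^ k : ℕ) : ℝ) = (L : ℝ) ^ k := by push_cast; ring
  have hd0 : ∀ y y' : Tor (TGIndex.Mn d hL ⟨mT, k, hk, m⟩), 0 ≤ tdistT (TGIndex.Mn d hL ⟨mT, k, hk, m⟩) y y' := fun y y' => tdistT_nonneg _ _ _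
  obtain ⟨HP1, HP2⟩ := HP mT k m hk
  refine ⟨?_, ?_, ?_, ?_, ?_, ?_, ?_, ?_, ?_, ?_, ?_, ?_, ?_⟩
  · exact hasMaj_rate_mono hC₀.le hδ₀' (hasMaj_gOp_of_ineq (TGIndex.Mn d hL ⟨mT, k, hk, m⟩) k (L ^ k) b hn1 HP1 hC₀.le)
  · intro μ
    rw [fgD, ← symbOp_sD_eq]
    exact hasMaj_rate_mono hC₀.le hδ₀' (hasMaj_grad_of_ineq (TGIndex.Mn d hL ⟨mT, k, hk, m⟩) k (L ^ k) b hn1 HP1 hC₀.le μ)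
  · rw [blkFine_comp_kingPrV]
    exact hasMaj_rate_mono hC₀.le hδ₀' (hasMaj_gOp_of_ineq (TGIndex.Mn d hL ⟨mT, k, hk, m⟩) k (L ^ m * L ^ k) b hn1' HP2 hC₀.le)
  · intro μ
    rw [fgD, ← symbOp_sD_eq, blkFine_comp_kingPrV]
    exact hasMaj_rate_mono hC₀.le hδ₀' (hasMaj_grad_of_ineq (TGIndex.Mn d hL ⟨mT, k, hk, m⟩) k (L ^ m * L ^ k) b hn1' HP2 hC₀.le μ)
  · rw [blkFine_comp_kingPrV]
    exact hasMaj_rate_mono hC₀.le hδ₀' (hasMaj_lap_of_ineq (TGIndex.Mn d hL ⟨mT, k, hk, m⟩) k (L ^ m * L ^ k) b hn1' HP2 hC₀.le)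
  · rw [blkFine_comp_kingPrV]
    refine (H0 mT k m hk hL).mono fun y y' => ?_
    rw [hcast, show -(2 * γ / 2) = -γ by ring]
    exact le_rate hC₁.le (by rw [hm₀def]; linarith [hC₅.le, hC₃.le]) hx1 le_rfl hδ₁' (hd0 y y')
  · intro μ
    rw [fgD, fgD, ← symbOp_sD_eq, ← symbOp_sD_eq, blkFine_comp_kingPrV]
    refine (H1 mT k m hk hL μ).mono fun y y' => ?_
    rw [hcast]
    exact le_rate hC₅.le (by rw [hm₀def]; linarith [hC₁.le, hC₃.le]) hx1 hγ1 hδ₅' (hd0 y y')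
  · rw [blkFine_comp_kingPrV]
    refine (H3 mT k m hk hL).mono fun y y' => ?_
    rw [hcast, show -(2 * γ / 2) = -γ by ring]
    exact le_rate hC₃.le (by rw [hm₀def]; linarith [hC₁.le, hC₅.le]) hx1 le_rfl hδ₃' (hd0 y y')
  · intro ν'
    rw [← symbOp_sTinv_sub_one_eq]
    exact hasMaj_rate_mono hC₀.le hδ₀' (hasMaj_gDivAdj_of_ineq (TGIndex.Mn d hL ⟨mT, k, hk, m⟩) k (L ^ k) b hn1 HP1 hC₀.le ν')
  · intro ν'
    rw [← symbOp_sTinv_sub_one_eq, blkFine_comp_kingPrV]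
    exact hasMaj_rate_mono hC₀.le hδ₀' (hasMaj_gDivAdj_of_ineq (TGIndex.Mn d hL ⟨mT, k, hk, m⟩) k (L ^ m * L ^ k) b hn1' HP2 hC₀.le ν')
  · intro μ
    exact hasMaj_fshift (TGIndex.Mn d hL ⟨mT, k, hk, m⟩) k (L ^ k) hδ.le μ
  · intro μ
    rw [blkFine_comp_kingPrV]
    exact hasMaj_fshift (TGIndex.Mn d hL ⟨mT, k, hk, m⟩) k (L ^ m * L ^ k) hδ.le μ
  · intro U α₀ hreg μ
    obtain ⟨⟨⟨hsc, hsa⟩, hoc, hoa⟩, hga, hga', hfaT, hfgT, hosc⟩ := hreg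
    set r : ℝ := c35 * (unitTorusGeo L k (TGIndex.Mn d hL ⟨mT, k, hk, m⟩)).M * α₀ with hrdef
    -- the sup letter is nonnegative as soon as one coefficient value is bounded by it
    have hr0 : 0 ≤ r := (abs_nonneg _).trans (hsc 0)
    have hrθ0 : 0 ≤ r * ((L : ℝ) ^ k) ^ (-γ) := mul_nonneg hr0 hxθ
    have ha : ∀ μ' x, |(avg₁ (Fin (d + 1)) (kingPrV L k m (TGIndex.Mn d hL ⟨mT, k, hk, m⟩)) U).2 μ' x| ≤ r := fun μ' => abs_blockAvg_le _ hr0 (hsa μ')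
    have hCa := hasMaj_mulOp_translate (g := unitTorusGeo L k (TGIndex.Mn d hL ⟨mT, k, hk, m⟩)) (blkFine L k (TGIndex.Mn d hL ⟨mT, k, hk, m⟩))
      (τ := fun μ => bshiftEquiv (TGIndex.Mn d hL ⟨mT, k, hk, m⟩) (L ^ k) μ) hr0 ha μ
    have hOsc := hasMaj_mulOp_sub_translate (g := unitTorusGeo L k (TGIndex.Mn d hL ⟨mT, k, hk, m⟩)) (blkFine L k (TGIndex.Mn d hL ⟨mT, k, hk, m⟩))
      (τ := fun μ => bshiftEquiv (TGIndex.Mn d hL ⟨mT, k, hk, m⟩) (L ^ k) μ) (a := (avg₁ (Fin (d + 1)) (kingPrV L k m (TGIndex.Mn d hL ⟨mT, k, hk, m⟩)) U).2) μ hrθ0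
      (hosc μ)
    have hCaS := pull_comp_mulOp_translate' (τ := fun μ => bshiftEquiv (TGIndex.Mn d hL ⟨mT, k, hk, m⟩) (L ^ k) μ)
      (a := (avg₁ (Fin (d + 1)) (kingPrV L k m (TGIndex.Mn d hL ⟨mT, k, hk, m⟩)) U).2) μ
    have key := H4 mT k m hk hL μ _ _ r (r * ((L : ℝ) ^ k) ^ (-γ)) hr0 hrθ0 hCaS hCa hOsc
    refine key.mono fun y y' => ?_
    rw [hcast]
    have hE : Real.exp (-(δ₄ * tdistT (TGIndex.Mn d hL ⟨mT, k, hk, m⟩) y y')) ≤ Real.exp (-(δ * tdistT (TGIndex.Mn d hL ⟨mT, k, hk, m⟩) y y')) :=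
      Real.exp_le_exp.mpr (by nlinarith [hd0 y y'])
    have heq : C₄ * (r * ((L : ℝ) ^ k) ^ (-γ) + r * ((L : ℝ) ^ k) ^ (-γ)) = 2 * C₄ * r * ((L : ℝ) ^ k) ^ (-γ) := by ring
    calc C₄ * (r * ((L : ℝ) ^ k) ^ (-γ) + r * ((L : ℝ) ^ k) ^ (-γ)) * Real.exp (-(δ₄ * tdistT (TGIndex.Mn d hL ⟨mT, k, hk, m⟩) y y'))
        ≤ C₄ * (r * ((L : ℝ) ^ k) ^ (-γ) + r * ((L : ℝ) ^ k) ^ (-γ)) * Real.exp (-(δ * tdistT (TGIndex.Mn d hL ⟨mT, k, hk, m⟩) y y')) :=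
          mul_le_mul_of_nonneg_left hE (by positivity)
      _ = 2 * C₄ * r * ((L : ℝ) ^ k) ^ (-γ) * Real.exp (-(δ * tdistT (TGIndex.Mn d hL ⟨mT, k, hk, m⟩) y y')) := by rw [heq]

end Letters

/-! ## §3 ★★★ `NE2PlusOperator` BY NAME for Bałaban's FULL `U ≡ 1` propagator dressed by a LIVE first-order scalar background, modulo the `U ≡ 1` entry-2 η-defect -/

section Node

variable (d)

/-- ★★★ **`T4EtaRate.NE2PlusOperator` BY NAME FOR BAŁABAN's FULL `U ≡ 1` LANDAU-GAUGE PROPAGATOR DRESSED BY A LIVE FIRST-ORDER SCALAR BACKGROUND, MODULO ONLY THE `U ≡ 1`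
ENTRY-2 η-DEFECT.**  On the torus family of record (`M_μ = 2L^{m_T}`, spacings `L^{−k}` ∕ `L^{−m−k}`, King's pairing; odd `L ≥ 3`, `b > 0`, `c₃₅ > 0`, rate exponent `0 < γ ≤ 1∕16`):
IF the η-defect of the `U ≡ 1` entry 2 of Bałaban's pair obeys `𝔇(G′∇′_ν*, G∇_ν*) ≤ B₂·(L^k)^{−γ}·e^{−δ₂|y−y′|_T}` uniformly (dag-n15-a's entry 2 — parts 61–66 in flight; their
`T2` with `∇_ν* = ρ(n(s_ν⁻¹ − 1))`, FILE 4 `symbOp_sTinv_sub_one_eq`), THEN `NE2PlusOperator c₃₅ (fgInstance d hL γ) (fgFamily d hL b γ)` — the realised by-parts family whose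
four (3.42) entries are ALL CONSTRUCTED on `G = gOp` with the coefficient background `(c′, a′_μ)` LIVE (FILE 7a's carrier `coeffBgBP`: the (3.35)–(3.36) letters consumed on every
coefficient), ENTRY 2 = the by-parts dressed `G(U)∇_ν*` (FILE 6's identification), NO mixed piece `∇G∇*` anywhere; every other `U ≡ 1` input is a tree theorem (§2).
This is the located (G5) knit of HANDOFF §g7 in the form the full propagator can feed. [cite: Balaban1985BackgroundPropagators, Thm 3.1 p.397 (quantifier template); (3.35)–(3.36) p.396, (3.42) p.397, (3.52) p.400, (3.63)–(3.65) p.402 (shapes, mechanism); Balaban1984PropagatorsI, Prop. 1.2 (1.110)–(1.111) p.35] -/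
theorem ne2PlusOperator_fullG_byParts_of_entry2 (hLodd : Odd L) (hL2 : 2 ≤ L) (hL : Odd L ∧ 1 < L) {b : ℝ} (hb : 0 < b) (c35 : ℝ) (hc35 : 0 < c35)
    {γ : ℝ} (hγ0 : 0 < γ) (hγ1 : γ ≤ 1 / 16) {B₂ δ₂ : ℝ} (hB₂ : 0 ≤ B₂) (hδ₂ : 0 < δ₂)
    (h2 : ∀ (i : TGIndex) (ν : Fin (d + 1)),
      HasMaj (BlockNorm.ofBlocks (unitTorusGeo L i.k (TGIndex.Mn d hL i)) (blkFine L i.k (TGIndex.Mn d hL i)))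
        (BlockNorm.ofBlocks (unitTorusGeo L i.k (TGIndex.Mn d hL i)) (blkFine L i.k (TGIndex.Mn d hL i) ∘ kingPrV L i.k i.m (TGIndex.Mn d hL i)))
        (idef (pull (kingPrV L i.k i.m (TGIndex.Mn d hL i))) (pull (kingPrV L i.k i.m (TGIndex.Mn d hL i)))
          (gOp (TGIndex.Mn d hL i) (L ^ i.m * L ^ i.k) b ∘ₗ fgradAdj ((L ^ i.m * L ^ i.k : ℕ) : ℝ) (bshiftEquiv (TGIndex.Mn d hL i) (L ^ i.m * L ^ i.k) ν))
          (gOp (TGIndex.Mn d hL i) (L ^ i.k) b ∘ₗ fgradAdj ((L ^ i.k : ℕ) : ℝ) (bshiftEquiv (TGIndex.Mn d hL i) (L ^ i.k) ν)))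
        (fun y y' => B₂ * ((L : ℝ) ^ i.k) ^ (-γ) * Real.exp (-(δ₂ * tdistT (TGIndex.Mn d hL i) y y')))) :
    NE2PlusOperator c35 (fgInstance d hL γ) (fgFamily d hL b γ) := by
  obtain ⟨δ, β, m₀, cT, mT, hδ, hδδ₂, hβ, hm₀, hBm, hcT, hmT, H⟩ := uniform_layer_fullG d hLodd hL2 hL hb hγ0 hγ1 c35 hδ₂ hB₂
  have hL0 : L ≠ 0 := by omega
  have hLr : (0 : ℝ) < (L : ℝ) := by exact_mod_cast (show 0 < L by omega)
  have hLr1 : (1 : ℝ) ≤ (L : ℝ) := by exact_mod_cast (show 1 ≤ L by omega)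
  have hσ : 0 < δ / 12 := by positivity
  -- the displayed entry-2 defect, rescaled to the common constants
  have hDS : ∀ (i : TGIndex × Fin (d + 1)) (ν : Fin (d + 1)),
      HasMaj (BlockNorm.ofBlocks (unitTorusGeo L i.1.k (TGIndex.Mn d hL i.1)) (blkFine L i.1.k (TGIndex.Mn d hL i.1)))
        (BlockNorm.ofBlocks (unitTorusGeo L i.1.k (TGIndex.Mn d hL i.1)) (blkFine L i.1.k (TGIndex.Mn d hL i.1) ∘ kingPrV L i.1.k i.1.m (TGIndex.Mn d hL i.1)))
        (idef (pull (kingPrV L i.1.k i.1.m (TGIndex.Mn d hL i.1))) (pull (kingPrV L i.1.k i.1.m (TGIndex.Mn d hL i.1)))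
          (gOp (TGIndex.Mn d hL i.1) (L ^ i.1.m * L ^ i.1.k) b ∘ₗ fgradAdj ((L ^ i.1.m * L ^ i.1.k : ℕ) : ℝ) (bshiftEquiv (TGIndex.Mn d hL i.1) (L ^ i.1.m * L ^ i.1.k) ν))
          (gOp (TGIndex.Mn d hL i.1) (L ^ i.1.k) b ∘ₗ fgradAdj ((L ^ i.1.k : ℕ) : ℝ) (bshiftEquiv (TGIndex.Mn d hL i.1) (L ^ i.1.k) ν)))
        (fun y y' => m₀ * ((L : ℝ) ^ i.1.k) ^ (-γ) * Real.exp (-(δ * (unitTorusGeo L i.1.k (TGIndex.Mn d hL i.1)).dist y y'))) := fun i ν =>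
    (h2 i.1 ν).mono fun y y' => le_rate hB₂ hBm (one_le_pow₀ hLr1) le_rfl hδδ₂ (tdistT_nonneg _ _ _)
  exact ne2PlusOperator_byParts (I := TGIndex × Fin (d + 1)) (J := Fin (d + 1)) (fun i => unitTorusGeo L i.1.k (TGIndex.Mn d hL i.1))
    (fun i => Tor (fine (L ^ i.1.k) (TGIndex.Mn d hL i.1)) × Fin (d + 1)) (fun i => Tor (fine (L ^ i.1.m * L ^ i.1.k) (TGIndex.Mn d hL i.1)) × Fin (d + 1))
    (fun i => blkFine L i.1.k (TGIndex.Mn d hL i.1)) (fun i => kingPrV L i.1.k i.1.m (TGIndex.Mn d hL i.1))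
    (fun i μ => bshiftEquiv (TGIndex.Mn d hL i.1) (L ^ i.1.k) μ) (fun i μ => bshiftEquiv (TGIndex.Mn d hL i.1) (L ^ i.1.m * L ^ i.1.k) μ)
    (fun i => ((L ^ i.1.k : ℕ) : ℝ)) (fun i => ((L ^ i.1.m * L ^ i.1.k : ℕ) : ℝ)) (fun i => i.1.m) (fun _ => Nat.cast_ne_zero.mpr hL0)
    (fun i => ((L : ℝ) ^ i.1.k) ^ (-γ)) (fun i => ((L : ℝ) ^ i.1.k) ^ (-γ)) (fun i => i.2)
    (fun i => gOp (TGIndex.Mn d hL i.1) (L ^ i.1.k) b)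
    (fun i => symbOp (TGIndex.Mn d hL i.1) (L ^ i.1.k) (sLap (TGIndex.Mn d hL i.1) (L ^ i.1.k) ((L ^ i.1.k : ℕ) : ℝ)) ∘ₗ gOp (TGIndex.Mn d hL i.1) (L ^ i.1.k) b)
    (fun i => fgD d (TGIndex.Mn d hL i.1) (L ^ i.1.k) b)
    (fun i => gOp (TGIndex.Mn d hL i.1) (L ^ i.1.m * L ^ i.1.k) b)
    (fun i => symbOp (TGIndex.Mn d hL i.1) (L ^ i.1.m * L ^ i.1.k) (sLap (TGIndex.Mn d hL i.1) (L ^ i.1.m * L ^ i.1.k) ((L ^ i.1.m * L ^ i.1.k : ℕ) : ℝ)) ∘ₗ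
      gOp (TGIndex.Mn d hL i.1) (L ^ i.1.m * L ^ i.1.k) b)
    (fun i => fgD d (TGIndex.Mn d hL i.1) (L ^ i.1.m * L ^ i.1.k) b)
    c35 hc35 (fun i => triangle254_unitTorusGeo L i.1.k (TGIndex.Mn d hL i.1)) (fun i a c => tdistT_nonneg _ _ _) (fun i y => tdistT_self _ y) hσ.le
    (B4Sect5Proof.latticeConst_nonneg (d + 1) hσ.le) (fun i => rowSum_unitTorusGeo L i.1.k (TGIndex.Mn d hL i.1) hσ)
    (fun i => inv_pos.mpr (pow_pos hLr _)) (fun i => hLr) (fun i y => (unitTorusGeo_len L i.1.k (TGIndex.Mn d hL i.1) hL0 y).symm.le)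
    (by linarith) hβ.le hm₀.le hγ0 (fun i => Real.rpow_nonneg (pow_nonneg hLr.le _) _) (fun i y => le_rfl) hcT.le hmT.le
    (fun i => (H i).1) (fun i => (H i).2.1) (fun i => (H i).2.2.1) (fun i => (H i).2.2.2.1) (fun i => (H i).2.2.2.2.1) (fun i => (H i).2.2.2.2.2.1)
    (fun i => (H i).2.2.2.2.2.2.1) (fun i => (H i).2.2.2.2.2.2.2.1) (fun i => (H i).2.2.2.2.2.2.2.2.1) (fun i => (H i).2.2.2.2.2.2.2.2.2.1)
    (fun i ν => hDS i ν) (fun i => (H i).2.2.2.2.2.2.2.2.2.2.1) (fun i => (H i).2.2.2.2.2.2.2.2.2.2.2.1) (fun i => (H i).2.2.2.2.2.2.2.2.2.2.2.2)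

end Node

/-! ## §4 ★★★ HYPOTHESIS-FREE: the `U ≡ 1` entry-2 η-defect IS a tree theorem (dag-n15-a part 71 `hasMaj_twoGridDefect_div`, exponent `1∕(8(d+1))`) -/

section Free

variable (d)

/-- ★★★ **`T4EtaRate.NE2PlusOperator` BY NAME, NO DISPLAYED BINDER: Bałaban's FULL `U ≡ 1` Landau-gauge propagator `G = Δ_b⁻¹` on the torus family of record, dressed by a LIVE
first-order scalar background (FILE 7a's carrier `coeffBgBP`, the (3.35)–(3.36) letters consumed on every coefficient), ALL FOUR (3.42) entries CONSTRUCTED (entry 2 by parts, =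
`G(U)∇_ν*` by FILE 6's identification), rate exponent `γ = 1∕(8(d+1))` (`d ≥ 1`)** — §3's theorem fed with dag-n15-a's ENTRY 2 (part 71 `hasMaj_twoGridDefect_div`, in its
`ρ(n(s_ν⁻¹ − 1))` form, bridged by FILE 4 `symbOp_sTinv_sub_one_eq`).  Every input is a tree theorem: (1.110) majorants (part 42), η-defects of `G` (p519229), `∇G` (part 59), `ΔG`
(entry 3), `G∇*` (part 71), the shift letters (FILE 4).  MODEL-LEVEL in the background species (abelianised first-order coefficients, block-averaged coarse partner), GENUINE in the
propagator. [cite: Balaban1985BackgroundPropagators, Thm 3.1 p.397 (quantifier template); (3.35)–(3.36) p.396, (3.42) p.397, (3.52) p.400, (3.63)–(3.65) p.402 (shapes, mechanism); Balaban1984PropagatorsI, Prop. 1.2 (1.110)–(1.111) p.35] -/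
theorem ne2PlusOperator_fullG_byParts (hd1 : 1 ≤ d) (hLodd : Odd L) (hL2 : 2 ≤ L) (hL : Odd L ∧ 1 < L) {b : ℝ} (hb : 0 < b) (c35 : ℝ) (hc35 : 0 < c35) :
    NE2PlusOperator c35 (fgInstance d hL (1 / (8 * ((d : ℝ) + 1)))) (fgFamily d hL b (1 / (8 * ((d : ℝ) + 1)))) := by
  obtain ⟨δ₂, B₂, hδ₂, hB₂, H2⟩ := hasMaj_twoGridDefect_div (d := d) hLodd hL2 hb
  have hd1' : (1 : ℝ) ≤ (d : ℝ) := by exact_mod_cast hd1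
  have hγ0 : 0 < 1 / (8 * ((d : ℝ) + 1)) := by positivity
  have hγ1 : 1 / (8 * ((d : ℝ) + 1)) ≤ 1 / 16 := one_div_le_one_div_of_le (by norm_num) (by nlinarith)
  refine ne2PlusOperator_fullG_byParts_of_entry2 d hLodd hL2 hL hb c35 hc35 hγ0 hγ1 hB₂.le hδ₂ fun i ν => ?_
  have h := H2 i.mT i.k i.m i.one_le hL ν
  rw [← symbOp_sTinv_sub_one_eq, ← symbOp_sTinv_sub_one_eq, blkFine_comp_kingPrV]
  refine h.mono fun y y' => le_of_eq ?_
  rw [show ((L ^ i.k : ℕ) : ℝ) = (L : ℝ) ^ i.k by push_cast; ring]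
  exact rfl

/-- The four-dimensional instance (`d + 1 = 4`, `γ = 1∕32`). [cite: Balaban1985BackgroundPropagators, Thm 3.1 p.397 (quantifier template)] -/
theorem ne2PlusOperator_fullG_byParts_dim4 (hLodd : Odd L) (hL2 : 2 ≤ L) (hL : Odd L ∧ 1 < L) {b : ℝ} (hb : 0 < b) (c35 : ℝ) (hc35 : 0 < c35) :
    NE2PlusOperator c35 (fgInstance 3 hL (1 / (8 * ((3 : ℕ) : ℝ) + 8))) (fgFamily 3 hL b (1 / (8 * ((3 : ℕ) : ℝ) + 8))) := by
  have h := ne2PlusOperator_fullG_byParts 3 (by norm_num) hLodd hL2 hL hb c35 hc35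
  rw [show (8 : ℝ) * ((3 : ℕ) : ℝ) + 8 = 8 * (((3 : ℕ) : ℝ) + 1) by ring]
  exact h

end Free

end Summit.QuantumFields.YangMills.BalabanUVNodes.N15.BackgroundLayer

end
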